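import Mathlib
import HarnessLib
import HarnessLib.Audit
import Summits.CriticalPhenomena.Statement
import Literature.Probability.LatticeModels.GKSInequalities
import Summits.CriticalPhenomena.Ising3DConformalLimit.Theorems.HyperoctahedralRPCriticalCorrNineMirrorRP
import HarnessLib.Audit.Status.Attr

/-!
Route: PrecisionLaplacian

DORMANT since 2026-08-26T06:31:34Z (reconciler: no traction for 8.4 d (last activity item-evidence-added at 2026-08-17T20:42:19Z); parked, not closed — `ledger route dormant route-CriticalPhenomena-PrecisionLaplacian --off` to reactivat) — unstaffed, not closed; items shared with open routes are served there. `ledger route dormant <id> --off` reactivates.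

# Route PrecisionLaplacian — the precision operator of the critical spin field is a Laplacian —
inverse-M for zero-field ferromagnets makes ⟨σ₀σ_x⟩ at β_c(3) the Green function of a positive-rate
Lévy flight of index 2−η

It suffices to show X_PL = IM ∧ TAIL ∧ L_iso together with the two imported complements MoebGivenLaw
and NonGauss
(idea card precision-is-a-laplacian, which absorbed levy-flight-inverse-m). Writing G :=
⟨σ₀σ_x⟩⁺_{β_c(3)} =
criticalTwoPoint 3, G_A for its principal submatrix on a finite A ⊂ ℤ³ and a(x) := inf_A
−(G_A⁻¹)(0,x) (the DIRECT
CORRELATION FUNCTION; under IM the infimum is a monotone limit):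
 IM    [crux r2, InverseMFerromagnet] for every finite zero-field pair ferromagnet (couplings K ≥ 0,
any graph) the
       matrix of spin second moments (⟨σ_xσ_y⟩) is an inverse M-matrix: (Σ⁻¹)_xy ≤ 0 for x ≠ y.
 TAIL  [crux r3, DirectCorrelationStableTail] if every G_A is a symmetric potential (inverse-M with
nonnegative
       inverse row sums — the infinite-volume form of IM, support InverseMCriticalKernel), then a is
asymptotically
       homogeneous: a(x)·|x|₂^(5−η) − Φ(x/|x|₂) → 0 for some η ∈ (0,1) and a continuous Φ ≥ 0, Φ ≢ 0
on S².
 L_iso [crux r4, StableConeRPRigidity] a positive kernel on ℝ³∖0, homogeneous of degree α−3 (1 ≤ α <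
2), which is
       the potential kernel of the symmetric α-stable law with angular Lévy density Φ and is
reflection positive in
       the nine lattice mirrors, is O(3)-invariant.
 MoebGivenLaw [crux r5, imported complement] the isotropic pure power law of G (item 0634 verbatim)
⇒ a
       non-degenerate Möbius-covariant pointwise scaling limit exists (item 1344 verbatim).
 NonGauss [crux r6 = item 0636, shared] every non-degenerate pointwise scaling limit has U₄ ≢ 0.
Glue (supports): InverseMCriticalKernel (IM ⇒ the critical kernel is a symmetric potential),
PrecisionIsLaplacian
(then −G⁻¹ = A₀δ₀ − a is a conservative Laplacian: G = A₀⁻¹ Σ_n (a/A₀)^{*n}, the Green function of a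
positive-rate
random walk — Ornstein–Zernike with c ≥ 0 made literal), TwoPointSpineGlue (TAIL + Williamson's
Green-function
asymptotics for walks attracted to a stable law + nine-mirror RP inheritance + L_iso ⇒ item 0634:
G(x)|x|₂^(1+η) → c),
EtaBoundsTransfer (two-sided variant ⇒ HasIsingEtaBounds 3 η ⇒ item 0635), CriticalCorrNineMirrorRP
(item 1985).
Lean: `InverseMFerromagnet ∧ DirectCorrelationStableTail ∧ StableConeRPRigidity ∧
MoebiusLimitOfTwoPointLaw ∧ IsingEuclidUpgradeR4NonGaussian`

## Assembly
Pure logic given the glue items (checked sorry-free in the planner's Sketch.lean, theorem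
assembly_glue, 3 lines): from IM,
InverseMCriticalKernel gives the symmetric-potential property of the critical kernel;
DirectCorrelationStableTail turns it
into TAIL; TwoPointSpineGlue (fed the potential property, TAIL, StableConeRPRigidity and
CriticalCorrNineMirrorRP) yields the
isotropic pure power law of the two-point function (item 0634); MoebiusLimitOfTwoPointLaw produces
(ρ, Δ, S) with a
non-degenerate Möbius-covariant pointwise scaling limit; IsingEuclidUpgradeR4NonGaussian (0636)
applied to (ρ, S) gives
HasNontrivialU4 S; the tuple is Ising3DConformalLimit (root abbrev of the conjunct =
Literature.Probability.LatticeModels.CritIsing3DConformalLimit). PrecisionIsLaplacian and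
EtaBoundsTransfer are dividends
(the second reaches item 0635 from two-sided tail bounds) and are not antecedents.

Rationale: WHY THIS LINE. The card transplants, with an explicit dictionary, the algebraic-statistics /
potential-theory fact "an attractive
Gaussian law is MTP₂ iff its precision matrix is an M-matrix" (KarlinRinott1983; posed for
palindromic Ising models and
proved on cycles only in LauritzenUhlerZwiernik2021 §5 Prop. 5.3, arXiv:1905.00516 p. 15) to
zero-field ferromagnets:
inverse-M ⇔ G is the Green kernel of a killed reversible jump process
(DellacherieMartinezSanmartin2014, complete maximum
principle), so at β_c — where the killing rate 1/χ vanishes — ⟨σ₀σ_x⟩ = A₀⁻¹Σ_n q^{*n} for ONE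
positive iid step law
q = a/A₀ on ℤ³, and the two-point spine of every route (items 0634/0635: power law, η, isotropy; the
inputs of
IsingEuclidUpgrade (E), HyperoctahedralRP (C), PerfectScreening, every-scale-regular…) becomes
renewal/Tauberian theory of
that step law: η = 2 − (stability index of a), criticality = conservativity, isotropy = uniform
spectral measure
(Williamson1968; BassLevin2002; Berger2019), positivity of a being exactly the Tauberian condition
that Fourier-side
arguments (FrohlichSimonSpencer1976, MessagerMiracleSoleJSP1977, AizenmanDuminilCopinAnnals2021 §5,
DuminilcopinPanis2025)
lack. Imported areas: M-matrix / potential theory of nonnegative matrices, limit theory of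
heavy-tailed random walks,
reflection positivity restricted to the stable cone (harmonic analysis). What it does that prior
routes do not: no
existing route or negative touches G⁻¹; PerfectScreening signs ΔG (a local second difference of G),
this line signs the
fully resummed 1PI kernel and turns the anomalous dimension into a heavy tail of a positive object;
the card's ~1600
exact finite-volume checks (2D/3D tori up to 3×3×6 at β_c, random graphs n ≤ 13, adversarial
gadgets) found no violation.

RANKED CRUXES. #2 InverseMFerromagnet (crux) — (card M1, conjecture IM =
LauritzenUhlerZwiernik2021's question beyond cycles) for sites Fin n, couplings K_i ≥ 0 on pairs C_i
(|C_i| = 2) and ZERO field, the law ν_{Λ;K} ∝ exp(Σ_i K_i σ_{C_i}) (gksExpect, FriedliVelenik2017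
§3.8.1) has spin second-moment matrix Σ_xy = ⟨σ_xσ_y⟩ with (Σ⁻¹)_xy ≤ 0 for x ≠ y (Σ is positive
definite, so Matrix.inv is the true inverse). Equivalently: all linear-regression coefficients of
σ_x on the other spins are ≥ 0 (inverse-M = potential of a transient chain up to a positive diagonal
scaling, DMS 2014); on vertex-transitive graphs Σ⁻¹ is moreover diagonally dominant with row sums
1/χ, i.e. Σ is the Green kernel of a killed reversible walk. Covers n.n. tori, free boxes and (ghost
site) plus boxes. True on trees, cycles (LUZ Prop 5.3), Curie–Weiss, to order β³ on any graph, and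
in ~1600 exact checks (card + triage refuter: 2D/3D tori incl. 3×3×L at β_c(3), random ferromagnets
n ≤ 13, adversarial gadgets), 0 violations; FALSE with mixed-sign fields and for bond-energy
covariances (controls). [difficulty: open-problem] (why it might fail: Proved only on cycles (LUZ
2021 Prop 5.3) and false for MTP₂ Ising laws WITH fields; marginalising a spin leaves the pair
class, so no Schur/induction: a new inequality (all regression coefficients of σ_x on the rest ≥ 0)
is needed; evidence stops at 54 sites (3×3×6 torus), 2D L ≤ 8, graphs n ≤ 13.)
[LauritzenUhlerZwiernik2021, arXiv:1905.00516, KarlinRinott1983, DellacherieMartinezSanmartin2014,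
FriedliVelenik2017, Literature.Probability.LatticeModels.gksExpect]
#3 DirectCorrelationStableTail (crux) — (card M2, the tail dictionary; existence of η RELOCATED to
one positive step law) assume the infinite-volume form of IM for the critical kernel G =
criticalTwoPoint 3 (hypothesis written out: every principal submatrix G_A, A ⊂ ℤ³ finite, is
positive definite and (G_A)⁻¹ is a Z-matrix with nonnegative row sums — the conclusion of support
InverseMCriticalKernel). Then the direct correlation function a(x) := inf_{A ∋ 0,x} −((G_A)⁻¹)(0,x)
(≥ 0, a monotone limit under the hypothesis by Schur complementation) is asymptotically homogeneous
of degree −(5−η): there are η ∈ (0,1) and Φ continuous, ≥ 0, ≢ 0 on the unit sphere with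
a(x)·|x|₂^(5−η) − Φ(x/|x|₂) → 0 cofinitely. Reading: q = a/A₀ is attracted to a genuinely
3-dimensional (2−η)-stable law with spectral density ∝ Φ; consistent iff η > 0 (F⁻¹|k|^(2−η) < 0 off
0) and matches Ĝ(k) ≍ |k|^(−2+η); predicted 5 − η ≈ 4.964. [deps: InverseMFerromagnet] [difficulty:
open-problem] (why it might fail: η's existence is relocated, not removed: a may carry a
log-periodic/slowly varying factor (RP+GKS two-point axiomatics admit them: card
rp-cannot-fix-the-scale-log-periodic) or lose pointwise regularity while G stays regular; Φ might
vanish on a cone of directions.) [DuminilcopinPanis2025, AizenmanDuminilCopinAnnals2021,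
DuminilCopinICM2022, Williamson1968, Berger2019, MessagerMiracleSoleJSP1977,
Summits/CriticalPhenomena/Ising3DConformalLimit/Ideas/precision-is-a-laplacian.md]
#4 StableConeRPRigidity (crux) — (card M3, isotropy lemma L_iso; pure harmonic analysis, the
stable-cone special case of item 1979 HRP2Rigidity) let 1 ≤ α < 2, Φ continuous, even, ≥ 0 and ≢ 0
on the unit sphere of ℝ³, and K > 0 continuous on ℝ³∖0, homogeneous of degree α−3, the potential
kernel of the symmetric α-stable Lévy process with Lévy density |z|^(−3−α)Φ(z/|z|) (stated without
Fourier transforms: ∫K(x−y)(L_Φ f)(y)dy = −f(x) for every C² compactly supported f, L_Φ f(y) =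
½∫(f(y+z)+f(y−z)−2f(y))|z|^(−3−α)Φ(ẑ)dz). If K is invariant and reflection positive (finite sums
over points of the open half-space) for each of the nine lattice mirrors n ∈ {e_i, e_i ± e_j}, then
K is invariant under every linear isometry of ℝ³ (equivalently Φ is constant). Mechanism (card):
RP_n + homogeneity make s ↦ K̂(√s·n + q) = 1/ψ_Φ Stieltjes per mirror; coordinate mirrors are
satisfied by the anisotropic ψ = Σ_i|k_i|^α, but in a face-DIAGONAL normal variable 1/(c·s^(α/2) +
C(q)) has a branch point on the positive axis unless the spectral measure is uniform. 2Δ = 3 − α = 1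
+ η: the Ising window Δ ∈ (1/2, 1]. [difficulty: L] (why it might fail: Coordinate-mirror RP is
compatible with anisotropy in the stable cone (ψ = Σ|k_i|^α); the bet is the diagonal mirrors — an
even Φ ≢ const whose kernel keeps all nine Stieltjes sections may exist for α near 2, where the cone
degenerates to the Coulomb kernel.) [FrohlichIsraelLiebSimon1978, FrohlichEtAl1978,
BergChristensenRessel1984, Williamson1968, stmt-CriticalPhenomena-1979,
Summits/CriticalPhenomena/Ising3DConformalLimit/Ideas/hyperoctahedral-rp-rigidity.md]
#5 MoebiusLimitOfTwoPointLaw (crux) — (IMPORTED COMPLEMENT, where the two-point spine is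
load-bearing) if the critical two-point function on ℤ³ is asymptotically an isotropic pure power
law, ⟨σ₀σ_x⟩_{β_c}·|x|₂^(2Δ) → c > 0 (item 0634 IsingEuclidUpgradeR2RotInvPowerLaw, verbatim as
hypothesis), then the critical correlators have a non-degenerate pointwise scaling limit (ρ > 0 on
(0,1], Δ' > 0, S) that is Möbius covariant (item 1344 PerfectScreening.MoebiusLimitExists, verbatim
as conclusion: the conjunct minus clause (iii)). The two-point law supplies ρ(δ) = δ^(−Δ),
non-degeneracy and Möbius covariance of S₂ outright; what remains is existence/uniqueness of the n ≥
4 limits and their O(3)/inversion covariance — not attacked here (bets: IsingEuclidUpgrade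
0637/0638, HyperoctahedralRP 1980–1982, IsingCFTData 0665, cards
inversion-first-moebius-from-translations, rotations-are-boosts-modular). Existential conclusion: no
coincident-configuration junk (take S = 0 off NonCoincident). [difficulty: open-problem] (why it
might fail: Given the two-point law, full δ→0⁺ convergence for n ≥ 4, O(3) invariance of S_n and
inversion covariance remain open on ℤ³ (ICM 2022 §8.4); Euclid+scale ⇏ Möbius in general
(ScaleCovarianceNotMoebius) and no planar engine transposes (LiouvilleRigidity).)
[DuminilCopinICM2022, PolandRychkovVichi2019,
Literature.Barriers.CriticalPhenomena.ScaleCovarianceNotMoebius,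
Literature.Barriers.CriticalPhenomena.LiouvilleRigidity, stmt-CriticalPhenomena-0634,
stmt-CriticalPhenomena-1344, stmt-CriticalPhenomena-1982]
#6 IsingEuclidUpgradeR4NonGaussian (crux) — (IMPORTED COMPLEMENT = item 0636, shared with
IsingEuclidUpgrade and HyperoctahedralRP, verbatim) every non-degenerate pointwise scaling limit S
of the renormalised critical Ising correlators on ℤ³ has U₄ ≢ 0 on non-coincident configurations.
Not attacked here; the card's hinge (6) (bridge local time of the effective walk = switching density
G(x,u)G(u,y)/G(x,y)) is where the companion card currents-are-stable-bridges continues toward clause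
(iii). [difficulty: open-problem] (why it might fail: No proof that U₄ ≢ 0 in d = 3: the
double-current intersection probability at macroscopic separation must stay > 0 as δ → 0; RP
long-range models ON ℤ³ (α < 3/2) are Gaussian (LongRangeTrivialityOnZ3).)
[AizenmanDuminilCopinAnnals2021, DuminilCopinICM2022, Panis2023Triviality,
Literature.Barriers.CriticalPhenomena.IsingTrivialityFromDimensionFour,
Literature.Barriers.CriticalPhenomena.LongRangeTrivialityOnZ3, stmt-CriticalPhenomena-0636]
#9 InverseMCriticalKernel (support) — (closure lemma, card M4) InverseMFerromagnet → the critical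
kernel of ℤ³ is a SYMMETRIC POTENTIAL on every finite set: for A ⊂ ℤ³ finite, G_A :=
(criticalTwoPoint 3 (q − p))_{p,q∈A} is positive definite, (G_A)⁻¹ has nonpositive off-diagonal
entries and nonnegative row sums. Proof sketch: IM on the n.n. torus (ℤ/Lℤ)³ at β_c (K ≡ β_c, zero
field); translation invariance gives (G_L)⁻¹𝟙 = 𝟙/χ_L ≥ 0, so G_L is a symmetric potential;
principal submatrices of symmetric potentials are symmetric potentials (Schur complement, DMS 2014
ch. 2–3) and entrywise limits with positive-definite limit stay in the class; torus (or ghost-site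
plus-box) two-point functions converge to criticalTwoPoint
(hasUniqueGibbsMeasure_criticalBeta_holds, hasBoxLimit_isingCorr_plus_holds,
twoPointPlus_criticalBeta_eq_twoPointFree); positive definiteness of the limit by finite energy
(conditional variance of σ₀ given the rest is bounded below). [difficulty: M]
[DellacherieMartinezSanmartin2014, Georgii2011, FriedliVelenik2017,
Literature.Probability.LatticeModels.hasUniqueGibbsMeasure_criticalBeta_holds,
Literature.Probability.LatticeModels.twoPointPlus_criticalBeta_eq_twoPointFree]
#9 PrecisionIsLaplacian (support) — (dictionary lemma, card M4/(1): 'the precision operator is a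
Laplacian') under the symmetric-potential hypothesis of InverseMCriticalKernel (written out), the
function m(y) := inf_{A ∋ 0,y} −((G_A)⁻¹)(0,y) (= a(y) ≥ 0 for y ≠ 0 and = −A₀ := −sup_A
(G_A)⁻¹(0,0) < 0 at y = 0) is summable, sums to ZERO (conservativity: the killing rate κ = A₀ − Σa =
lim 1/χ vanishes because χ(β_c) = ∞, via Bochner + Fejér and G ≥ 0), and is minus the convolution
inverse of G: Σ_y m(y)·G(z−y) = −δ_{z,0}. Hence G = A₀⁻¹ Σ_{n≥0} q^{*n} with probability step law q
= a/A₀ on ℤ³∖0 (transient positive-rate walk; Ornstein–Zernike h = c + c∗h with c ≥ 0), Ĝ = 1/ψ,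
ψ(k) = Σ_x a(x)(1 − cos k·x) a Lévy–Khintchine exponent, and the infrared bound ψ(k) ≥
½kᵀ(Σ_{|x|=1}a(x)xxᵀ)k is free. Ingredients: −(G_A)⁻¹(0,y) ↓ and (G_A)⁻¹(0,0) ↑ in A (Schur
complements of M-matrices); no defect since G → 0 (criticalTwoPoint_bounds); finite energy bounds
A₀. [difficulty: M] [DellacherieMartinezSanmartin2014, KarlinRinott1983, LawlerLimic2010,
CampaninoIoffeVelenik2003, Literature.Probability.LatticeModels.criticalTwoPoint_bounds,
Summits/CriticalPhenomena/Ising3DConformalLimit/Ideas/precision-is-a-laplacian.md]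
#9 EtaBoundsTransfer (support) — (two-sided dividend, card M2(i) upward; graceful-degradation path
to item 0635) under the symmetric-potential hypothesis, c|x|^(−(5−η)) ≤ a(x) ≤ C|x|^(−(5−η)) for all
x ≠ 0 with 0 < η < 1 implies HasIsingEtaBounds 3 η, hence item 0635 (∃η HasIsingExponentEta 3 η) by
HasIsingExponentEta.of_bounded. Proof: G = A₀⁻¹·(Green function of the discrete-time walk with
conductances C_xy = a(y−x) ≍ |x−y|^(−(3+α)), α = 2−η ∈ (1,2)); BassLevin2002 Thm 1.1: p_n(x,y) ≍
n^(−3/α) ∧ n|x−y|^(−3−α); sum over n. The converse (G two-sided ⇒ a two-sided) is NOT claimed.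
[difficulty: M] [BassLevin2002, DuminilCopinICM2022,
Literature.Probability.LatticeModels.HasIsingExponentEta.of_bounded, stmt-CriticalPhenomena-0635]
#9 CriticalCorrNineMirrorRP (support) — (lattice input = item 1985 of HyperoctahedralRP, verbatim;
FILS 1978) nine-mirror reflection positivity of the critical plus-state correlators on ℤ³
(coordinate, diagonal and anti-diagonal site mirrors through 0; finite sums over configurations
strictly inside the positive half-space). From isingMeasure_univ_free_reflectionPositive on
symmetric boxes + hasBoxLimit_isingCorr_plus_holds + closedness of RP under limits; needed by
TwoPointSpineGlue. [difficulty: provable-now] [FrohlichEtAl1978, FrohlichIsraelLiebSimon1978,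
FriedliVelenik2017, stmt-CriticalPhenomena-1985]
#9 TwoPointSpineGlue (support) — (glue of the foreseen split, kind glue; conclusion = item 0634
verbatim) symmetric-potential hypothesis → TAIL (conclusion of DirectCorrelationStableTail, written
out) → StableConeRPRigidity → CriticalCorrNineMirrorRP (written out) → ∃ Δ c > 0,
⟨σ₀σ_x⟩_{β_c}·|x|₂^(2Δ) → c cofinitely (with 2Δ = 1 + η). Chain: PrecisionIsLaplacian gives G =
A₀⁻¹Σ q^{*n}; TAIL puts q in the domain of normal attraction of a genuinely 3-dimensional symmetric
(2−η)-stable law with Lévy density ∝ |z|^(−5+η)Φ(ẑ) (aperiodic: a > 0 on far sites of an open cone);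
Williamson1968 (Thm p. 393 for 3/2 < α < 2; Cor. 3-B for d ≥ 2 under the pointwise tail regularity
TAIL provides; modern form Berger2019) gives G(x)·|x|₂^(1+η) − U(x̂) → 0 with U > 0 the continuous
degree-(−1−η) potential kernel of that law; nine-mirror RP and mirror invariance pass from the
lattice correlators to K = |x|^(−1−η)U(x̂) (finite sums, pointwise limits), which satisfies the
potential equation of StableConeRPRigidity with α = 2 − η; L_iso makes K radial, U ≡ c > 0: item
0634. To be split (Two-layer plan) once r3 or r4 closes. [difficulty: L] [Williamson1968,
Berger2019, FrohlichIsraelLiebSimon1978, DellacherieMartinezSanmartin2014,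
stmt-CriticalPhenomena-0634, stmt-CriticalPhenomena-1983]

TWO-LAYER PLAN. Foreseen glued splits (k ≤ 3, depth 1; nothing filed now): TwoPointSpineGlue ⇐
WalkGreenAsymptotics (PrecisionIsLaplacian +
TAIL ⇒ G|x|^(1+η) → U(x̂), Williamson/Berger) → LimitKernelRP (RP + potential equation of the limit
kernel) → TwoPointSpineGlue;
DirectCorrelationStableTail ⇐ TailExponent (two-sided a ≍ |x|^(−5+η); feeds EtaBoundsTransfer) →
TailRegularVariation →
AngularProfile; InverseMFerromagnet ⇐ TorusCase (n.n. tori, all β — all the assembly needs) →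
RegressionPositivity (general
graphs); StableConeRPRigidity ⇐ DiagonalMirrorBranchPoint (one diagonal mirror, smooth Φ) → general
Φ.

KILL CRITERIA. (a) ONE zero-field pair ferromagnet with a positive off-diagonal entry of Σ⁻¹ refutes
InverseMFerromagnet: a non-lattice
witness ⇒ REPAIR by restating r2 as its torus/ℤ³ case (the assembly only uses
InverseMCriticalKernel); an n.n. torus/box of ℤ³
witness at β ≤ β_c (kit: 4×4×L, 5×5×L transfer matrices; worm estimates of a = F⁻¹[1/Ĝ] on 64³) ⇒
close
`refuted:InverseMFerromagnet` — every dividend is conditional on it. (b) A proof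
that a(x) at β_c(3) is NOT asymptotically homogeneous (e.g. certified log-periodic modulation, or Φ
vanishing on a cone)
refutes r3: pivot to the two-sided branch (EtaBoundsTransfer → item 0635 only) and hand isotropy
back to HyperoctahedralRP.
(c) An anisotropic nine-mirror-RP stable potential kernel refutes StableConeRPRigidity AND item 1979
(HRP2Rigidity): drop
r4, keep the route as an η/0635 engine, isotropy then rests on the arithmetic cards
(pythagorean-endomorphisms,
harmonic-moments-isotropy). (d) Item 0634 proved elsewhere moots r3/r4/TwoPointSpineGlue (the route
then only offers the
OZ/0635 dividends); ¬0636 (a Gaussian limit) kills the conjunct itself, not just this route.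

NOT DECOMPOSED YET. The torus→ℤ³ passage and finite-energy positive definiteness inside
InverseMCriticalKernel; the Bochner–Fejér 'κ = 0' step
and the no-defect lemma inside PrecisionIsLaplacian; Williamson's side condition (supplied by
pointwise asymptotic
homogeneity) and aperiodicity of q; passage of RP to the limit kernel; the subcritical OZ dividend
(card (4): κ_β = 1/χ_β > 0
plus a tilted local CLT ⇒ CampaninoIoffeVelenik2003-type asymptotics) and the conformal-weight
remark (card (5): limit
Dirichlet form (−Δ)^((2−η)/2), Möbius weight (1+η)/2 = Δ_σ) — recorded, not filed; the
bridge-local-time = switching-density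
hinge (card (6)) belongs to currents-are-stable-bridges. No definition is requested: a(x) and the
potential property are
inlined (iInf over finite sets of a Matrix.inv entry), so the import cone adds no unproved named
fact.

CHEAPEST FALSIFIER. Exact enumeration / transfer-matrix inversion of the zero-field spin
second-moment matrix on the 4×4×4 and 4×4×6 tori and
the 4³ plus-box (ghost site) of ℤ³ at β ∈ {0.15, 0.2217, 0.30}, and 2D tori up to L = 12 across
β_c(2): one positive
off-diagonal entry of Σ⁻¹ kills r2 (the card's and the triage refuter's runs — 3×3×L ≤ 6, 2D L ≤ 8,
1641 random/adversarial
graphs, exact rationals — found none; smallest margins are exact zeros on cut vertices). Second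
cheapest: the sign and the
log-log slope (predicted −4.96) of a(x) = F⁻¹[1/Ĝ](x) from published high-precision Ĝ / G data at
β_c(3). Not run in
this session (hub is compute-free; no kit job submitted by this planner).

NUMBERS. η(3) ≈ 0.0363 (bootstrap/MC), so the predicted tail is a(x) ≍ |x|^(−4.964) and α = 2 − η ≈
1.964 ∈ (3/2, 2) = Williamson's
window d/2 < α < min(d,2); rigorous window: η ∈ [0, 1/2] if it exists (DuminilcopinPanis2025 Thm
1.5), Δ ∈ [1/2, 1]
(scalingDimension_mem_Icc). Card data at β_c on the 3×3×6 torus: largest off-diagonal entry of Σ⁻¹ =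
−1.3·10⁻⁴, n.n. entry
−0.28, diagonal 1.71, row sum = 1/χ_L > 0. High-temperature expansion on ℤ³: Σ⁻¹ = I − tA + 6t²I +
t³(A³ − 12A − N₃) + O(t⁴),
no positive off-diagonal entry through order t³. Items at open: 11 (5 cruxes, 5 support, 1
assembly).

DEFINITION REQUESTS. None filed: a(x) and the symmetric-potential property are inlined over
Matrix.inv / Matrix.PosDef and criticalTwoPoint;
gksExpect (FriedliVelenik2017 §3.8.1) carries r2, hence the import
Literature.Probability.LatticeModels.GKSInequalities.
Names provers may introduce in Theorems/: `directCorrelation 3 : Site 3 → ℝ`, `IsSymmetricPotential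
(M : Matrix A A ℝ)`.
Bib keys added this session: LauritzenUhlerZwiernik2021, KarlinRinott1983, Williamson1968,
BassLevin2002, Berger2019,
DellacherieMartinezSanmartin2014.

Novelty: Searches (2026-08-15): `lit galaxy search "inverse M-matrix" --star all` (23 rows: matrix-theory
monographs only — DMS LNM
2118 panama:391554988507136, Johnson–Smith–Tsatsomeros 'Matrix Positivity', Berman–Plemmons; 0
statistical-mechanics hits);
`lit search --source crossref "inverse M-matrix Ising model correlations ferromagnet"` (8 rows,
1970s series/planar papers,
nothing on Σ⁻¹); `lit search --source zbmath` for "total positivity multivariate binary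
distributions" (→ doi:10.1214/20-aos2007),
"M-matrices covariance matrices multinormal" (→ doi:10.1016/0024-3795(83)80027-5), "random walks
Riesz kernels Williamson"
(→ doi:10.2140/pjm.1968.25.393, READ pp. 393–395: theorem and window d/2 < α < min(d,2)),
"transition probabilities symmetric
jump processes" (→ BassLevin2002, READ p. 2933 Thm 1.1), "strong renewal theorems multivariate" (→
Berger2019); `lit read
arXiv:1905.00516 --grep M-matrix` (p. 15 Prop 5.3 and the sentence 'natural to ask … does not hold
in general for MTP₂ Ising
models'); `lit frontier CriticalPhenomena --since 2020` (30 rows, SLE/percolation/lace; none on G⁻¹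
or direct correlations);
`lit bridges CriticalPhenomena --cross any` (30 rows, none relevant); `ledger negatives` (1 refuted
statement, SAW conjunct,
unrelated); the five route files and ~100 card titles of the sub (no route or card other than this
card's retired duplicate
levy-flight-inverse-m touches Σ⁻¹, M-matrices or positive-step walk representations;
PerfectScreening signs ΔG instead).
Local s  [refs: 10.1214/20-aos2007, 10.1016/0024-3795(83, 10.2140/pjm.1968.25.393, 1905.00516, doi:10.1214/20-aos2007, doi:10.1016/0024-3795, doi:10.2140/pjm.1968.25.393, BassLevin2002, Berger2019, LauritzenUhlerZwiernik2021, KarlinRinott1983, DellacherieMartinezSanmartin2014, Williamson1968, CampaninoIoffeVelenik2003]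

Barriers (technique_class: inverse-M-matrix, random-walk-potential-theory): - technique_class: inverse-M-matrix, random-walk-potential-theory
- Literature.Barriers.CriticalPhenomena.LaceExpansionIsingAboveFour: not met — no expansion in a
small parameter; IM is a sign statement about the fully resummed kernel Σ⁻¹ = 1 − tJ − Π (the lace
coefficients enter only resummed), meaningful at d = 3, β = β_c; the transfer theorems are
exponent-sensitive (α = 2 − η), not mean-field.
- Literature.Barriers.CriticalPhenomena.IsingTrivialityFromDimensionFour: not engaged — the route's
own cruxes concern the two-point spine (clauses (i)–(ii) inputs); IM is deliberately
dimension-uniform like GKS, and the dictionary reproduces d ≥ 5 correctly (finite-variance step law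
⇔ G ~ |x|^(2−d)); non-triviality is the imported item 0636, whose d-specificity is discussed on its
home routes.
- Literature.Barriers.CriticalPhenomena.LongRangeTrivialityOnZ3: not engaged for the same reason;
note the dictionary is interaction-uniform too (for RP long-range models the imposed and emergent
fractional Laplacians coincide), which is consistent because this route claims nothing about U₄.
- Literature.Barriers.CriticalPhenomena.ScaleCovarianceNotMoebius: applies to the imported
complement r5 only (Euclid + scale ⇏ inversion); evasion is delegated (Ising-specific RP/locality
input on IsingEuclidUpgrade r5 re-typed as item 1982); at n = 2 Möbius covariance of c|x−y|^(−2Δ) is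
automatic, and the card's remark that the limit Dirichlet form (−Δ)^((2−η)/2) is Möbius covariant
with weight (1+η)/2

History (route lifecycle, newest last):
- 2026-08-26T06:31:34Z · DORMANT — reconciler: no traction for 8.4 d (last activity item-evidence-added at 2026-08-17T20:42:19Z); parked, not closed — `ledger route dormant route-CriticalPhenomen (operator:999:174318)

sub-problem: Ising3DConformalLimit · status: dormant · opened planner-plancard-CriticalPhenomena-Ising3DCon-52268d64-0 2026-08-15T11:35:07Z · rev 5 · ledger route-CriticalPhenomena-PrecisionLaplacian
GENERATED by the gate from the ledger (D-0016/17). Provers cite these decls: `theorem foo : Summit.CriticalPhenomena.Ising3DConformalLimit.Theses.PrecisionLaplacian.<Decl> := …` in Summits/CriticalPhenomena/Ising3DConformalLimit/Theorems/<Name>.lean.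
-/

namespace Summit.CriticalPhenomena.Ising3DConformalLimit.Theses.PrecisionLaplacian

open scoped BigOperators Topology Manifold Classical MeasureTheory ProbabilityTheory Matrix InnerProductSpace ComplexConjugate ContinuousMap
open Filter Set Function TopologicalSpace MeasureTheory

attribute [summit_statement] _root_.Ising3DConformalLimit

/-- item stmt-CriticalPhenomena-4798 · crux · rank 2 · open · by planner
why it might fail: Proved only on cycles (LUZ2021 Prop 5.3) and n ≤ 3; false with fields. For non-adjacent x,y the conditional covariance vanishes (Markov): (Σ⁻¹)_xy ≤ 0 is a bare sign claim on Cov of the nonlinear residuals of E[σ_x|∂x], E[σ_y|∂y], with no known inequality; checked n ≤ 13, 3×3×6 torus, HT order 11.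
sources: LauritzenUhlerZwiernik2021, arXiv:1905.00516, KarlinRinott1983, DellacherieMartinezSanmartin2014, FriedliVelenik2017, Literature.Probability.LatticeModels.gksExpect
[crux] (card M1, conjecture IM = LauritzenUhlerZwiernik2021's question beyond cycles) for sites Fin
n, couplings K_i ≥ 0 on pairs C_i (|C_i| = 2) and ZERO field, the law ν_{Λ;K} ∝ exp(Σ_i K_i σ_{C_i})
(gksExpect, FriedliVelenik2017 §3.8.1) has spin second-moment matrix Σ_xy = ⟨σ_xσ_y⟩ with (Σ⁻¹)_xy ≤
0 for x ≠ y (Σ is positive definite, so Matrix.inv is the true inverse). Equivalently: all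
linear-regression coefficients of σ_x on the other spins are ≥ 0 (inverse-M = potential of a
transient chain up to a positive diagonal scaling, DMS 2014); on vertex-transitive graphs Σ⁻¹ is
moreover diagonally dominant with row sums 1/χ, i.e. Σ is the Green kernel of a killed reversible
walk. Covers n.n. tori, free boxes and (ghost site) plus boxes. True on trees, cycles (LUZ Prop
5.3), Curie–Weiss, to order β³ on any graph, and in ~1600 exact checks (card + triage refuter: 2D/3D
tori incl. 3×3×L at β_c(3), random ferromagnets n ≤ 13, adversarial gadgets), 0 violations; FALSE
with mixed-sign fields and for bond-energy covariances (controls). [difficulty: open-problem] -/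
@[route_item "route-CriticalPhenomena-PrecisionLaplacian", crux]
def InverseMFerromagnet : Prop :=
  ∀ (n m : ℕ) (K : Fin m → ℝ) (C : Fin m → Finset (Fin n)), (∀ i, 0 ≤ K i) → (∀ i, (C i).card = 2) → ∀ x y : Fin n, x ≠ y → (Matrix.of fun (p q : Fin n) => Literature.Probability.LatticeModels.gksExpect Finset.univ K C (fun ω => Literature.Probability.LatticeModels.spinAt p ω * Literature.Probability.LatticeModels.spinAt q ω))⁻¹ x y ≤ 0

/-- item stmt-CriticalPhenomena-4799 · crux · rank 3 · open · by planner
why it might fail: Bets η(3) > 0, itself unproved (0 ≤ η ≤ 1, criticalTwoPoint_bounds; η ≤ 1/2 if it exists, DuminilcopinPanis2025 Thm 1.5): η = 0 makes the tail of a = F⁻¹[1/Ĝ] subleading, sign/exponent undetermined. Even with η > 0, a may carry a slowly varying or log-periodic factor, or Φ vanish on a cone.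
sources: DuminilcopinPanis2025, arXiv:2404.05700, DuminilCopinICM2022, AizenmanDuminilCopinAnnals2021, CampaninoIoffeVelenik2003, Williamson1968
[crux] (card M2, the tail dictionary; existence of η RELOCATED to one positive step law) assume the
infinite-volume form of IM for the critical kernel G = criticalTwoPoint 3 (hypothesis written out:
every principal submatrix G_A, A ⊂ ℤ³ finite, is positive definite and (G_A)⁻¹ is a Z-matrix with
nonnegative row sums — the conclusion of support InverseMCriticalKernel). Then the direct
correlation function a(x) := inf_{A ∋ 0,x} −((G_A)⁻¹)(0,x) (≥ 0, a monotone limit under the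
hypothesis by Schur complementation) is asymptotically homogeneous of degree −(5−η): there are η ∈
(0,1) and Φ continuous, ≥ 0, ≢ 0 on the unit sphere with a(x)·|x|₂^(5−η) − Φ(x/|x|₂) → 0 cofinitely.
Reading: q = a/A₀ is attracted to a genuinely 3-dimensional (2−η)-stable law with spectral density ∝
Φ; consistent iff η > 0 (F⁻¹|k|^(2−η) < 0 off 0) and matches Ĝ(k) ≍ |k|^(−2+η); predicted 5 − η ≈
4.964. [deps: InverseMFerromagnet] [difficulty: open-problem] -/
@[route_item "route-CriticalPhenomena-PrecisionLaplacian", crux]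
def DirectCorrelationStableTail : Prop :=
  (∀ A : Finset (Literature.Probability.LatticeModels.Site 3), (Matrix.of fun (p q : ↥A) => Literature.Probability.LatticeModels.criticalTwoPoint 3 (q.1 - p.1)).PosDef ∧ ∀ u v : ↥A, (u ≠ v → (Matrix.of fun (p q : ↥A) => Literature.Probability.LatticeModels.criticalTwoPoint 3 (q.1 - p.1))⁻¹ u v ≤ 0) ∧ 0 ≤ ∑ w, (Matrix.of fun (p q : ↥A) => Literature.Probability.LatticeModels.criticalTwoPoint 3 (q.1 - p.1))⁻¹ u w) → (∃ (η : ℝ) (Φ : (Fin 3 → ℝ) → ℝ), 0 < η ∧ η < 1 ∧ ContinuousOn Φ {u | ∑ i, u i ^ 2 = 1} ∧ (∀ u : Fin 3 → ℝ, ∑ i, u i ^ 2 = 1 → 0 ≤ Φ u) ∧ (∃ u : Fin 3 → ℝ, ∑ i, u i ^ 2 = 1 ∧ 0 < Φ u) ∧ Filter.Tendsto (fun x : Literature.Probability.LatticeModels.Site 3 => (⨅ A : {A : Finset (Literature.Probability.LatticeModels.Site 3) // (0 : Literature.Probability.LatticeModels.Site 3) ∈ A ∧ x ∈ A}, -((Matrix.of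 fun (p q : ↥A.1) => Literature.Probability.LatticeModels.criticalTwoPoint 3 (q.1 - p.1))⁻¹ ⟨0, A.2.1⟩ ⟨x, A.2.2⟩)) * Real.sqrt (∑ j, ((x j : ℝ)) ^ 2) ^ (5 - η) - Φ (fun i => (x i : ℝ) / Real.sqrt (∑ j, ((x j : ℝ)) ^ 2))) Filter.cofinite (nhds 0))

/-- item stmt-CriticalPhenomena-4800 · crux · rank 4 · closed · proved by Summit.CriticalPhenomena.Ising3DConformalLimit.Cruxes.StableConeRPRigidity.EntireProfileNullGrowth.StableConeRPRigidity_proof @ afc18b329f82 (prover) · by planner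
why it might fail: Coordinate mirrors cannot force isotropy even for smooth Φ > 0: ψ = Σ_i (k_i²+δ|k|²)^{α/2} has complete-Bernstein coordinate sections (RP) but a branch point in the upper half-plane on diagonal ones. Band-limited Φ = 1+εh fails every mirror; a rough full-spectrum Φ might survive, esp. as α → 2.
sources: FrohlichEtAl1978, FrohlichIsraelLiebSimon1978, BergChristensenRessel1984, SchillingSongVondracek2012, FrankLieb2010, NeebOlafsson2014
[crux] (card M3, isotropy lemma L_iso; pure harmonic analysis, the stable-cone special case of item
1979 HRP2Rigidity) let 1 ≤ α < 2, Φ continuous, even, ≥ 0 and ≢ 0 on the unit sphere of ℝ³, and K >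
0 continuous on ℝ³∖0, homogeneous of degree α−3, the potential kernel of the symmetric α-stable Lévy
process with Lévy density |z|^(−3−α)Φ(z/|z|) (stated without Fourier transforms: ∫K(x−y)(L_Φ f)(y)dy
= −f(x) for every C² compactly supported f, L_Φ f(y) = ½∫(f(y+z)+f(y−z)−2f(y))|z|^(−3−α)Φ(ẑ)dz). If
K is invariant and reflection positive (finite sums over points of the open half-space) for each of
the nine lattice mirrors n ∈ {e_i, e_i ± e_j}, then K is invariant under every linear isometry of ℝ³
(equivalently Φ is constant). Mechanism (card): RP_n + homogeneity make s ↦ K̂(√s·n + q) = 1/ψ_Φ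
Stieltjes per mirror; coordinate mirrors are satisfied by the anisotropic ψ = Σ_i|k_i|^α, but in a
face-DIAGONAL normal variable 1/(c·s^(α/2) + C(q)) has a branch point on the positive axis unless
the spectral measure is uniform. 2Δ = 3 − α = 1 + η: the Ising window Δ ∈ (1/2, 1]. [difficulty: L] -/
@[route_item "route-CriticalPhenomena-PrecisionLaplacian", crux]
def StableConeRPRigidity : Prop :=
  ∀ (α : ℝ) (Φ K : EuclideanSpace ℝ (Fin 3) → ℝ), 1 ≤ α → α < 2 → ContinuousOn Φ (Metric.sphere 0 1) → (∀ u ∈ Metric.sphere (0 : EuclideanSpace ℝ (Fin 3)) 1, 0 ≤ Φ u) → (∃ u ∈ Metric.sphere (0 : EuclideanSpace ℝ (Fin 3)) 1, 0 < Φ u) → (∀ u, Φ (-u) = Φ u) → ContinuousOn K {0}ᶜ → (∀ x, x ≠ 0 → 0 < K x) → (∀ c : ℝ, 0 < c → ∀ x, K (c • x) = c ^ (α - 3) * K x) → (∀ f : EuclideanSpace ℝ (Fin 3) → ℝ, ContDiff ℝ 2 f → HasCompactSupport f → ∀ x, (∫ y, K (x - y) * ((1/2 : ℝ) * ∫ z,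 (f (y + z) + f (y - z) - 2 * f y) * (‖z‖ ^ (-(3 + α)) * Φ (‖z‖⁻¹ • z)))) = - f x) → (∀ n : EuclideanSpace ℝ (Fin 3), (∃ i j : Fin 3, i ≠ j ∧ (n = EuclideanSpace.single i 1 ∨ n = EuclideanSpace.single i 1 + EuclideanSpace.single j 1 ∨ n = EuclideanSpace.single i 1 - EuclideanSpace.single j 1)) → (∀ x, K (((ℝ ∙ n)ᗮ).reflection x) = K x) ∧ (∀ (m : ℕ) (p : Fin m → EuclideanSpace ℝ (Fin 3)) (c : Fin m → ℝ), (∀ a, 0 < inner ℝ (p a) n) → 0 ≤ ∑ a, ∑ b, c a * c b * K (p a - ((ℝ ∙ n)ᗮ).reflection (p b)))) → ∀ (R : EuclideanSpace ℝ (Fin 3) ≃ₗᵢ[ℝ] EuclideanSpace ℝ (Fin 3)) (x : EuclideanSpace ℝ (Fin 3)), K (R x) = K x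

-- `StableConeRPRigidity` holds: proved by `Summit.CriticalPhenomena.Ising3DConformalLimit.Cruxes.StableConeRPRigidity.EntireProfileNullGrowth.StableConeRPRigidity_proof` @ afc18b329f82 (its module imports this route file, so no `_holds` link can be stated here).

/-- item stmt-CriticalPhenomena-4801 · crux · rank 5 · open · by planner
why it might fail: Given only the two-point power law, existence of the δ → 0⁺ limits for n ≥ 4, their O(3) invariance and inversion covariance are all open on ℤ³ (DuminilCopinICM2022 §8.4); Euclid + scale ⇏ Möbius (ScaleCovarianceNotMoebius), no planar engine in d = 3 (LiouvilleRigidity). It is item 0634 → item 1344.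
sources: DuminilCopinICM2022, PolandRychkovVichi2019, Literature.Barriers.CriticalPhenomena.ScaleCovarianceNotMoebius, Literature.Barriers.CriticalPhenomena.LiouvilleRigidity, stmt-CriticalPhenomena-0634, stmt-CriticalPhenomena-1344
[crux] (IMPORTED COMPLEMENT, where the two-point spine is load-bearing) if the critical two-point
function on ℤ³ is asymptotically an isotropic pure power law, ⟨σ₀σ_x⟩_{β_c}·|x|₂^(2Δ) → c > 0 (item
0634 IsingEuclidUpgradeR2RotInvPowerLaw, verbatim as hypothesis), then the critical correlators have
a non-degenerate pointwise scaling limit (ρ > 0 on (0,1], Δ' > 0, S) that is Möbius covariant (item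
1344 PerfectScreening.MoebiusLimitExists, verbatim as conclusion: the conjunct minus clause (iii)).
The two-point law supplies ρ(δ) = δ^(−Δ), non-degeneracy and Möbius covariance of S₂ outright; what
remains is existence/uniqueness of the n ≥ 4 limits and their O(3)/inversion covariance — not
attacked here (bets: IsingEuclidUpgrade 0637/0638, HyperoctahedralRP 1980–1982, IsingCFTData 0665,
cards inversion-first-moebius-from-translations, rotations-are-boosts-modular). Existential
conclusion: no coincident-configuration junk (take S = 0 off NonCoincident). [difficulty:
open-problem] -/
@[route_item "route-CriticalPhenomena-PrecisionLaplacian", crux]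
def MoebiusLimitOfTwoPointLaw : Prop :=
  (∃ Δ c : ℝ, 0 < c ∧ Filter.Tendsto (fun x : Literature.Probability.LatticeModels.Site 3 => Literature.Probability.LatticeModels.criticalTwoPoint 3 x * Real.sqrt (∑ i, ((x i : ℝ)) ^ 2) ^ (2 * Δ)) Filter.cofinite (nhds c)) → (∃ (ρ : ℝ → ℝ) (Δ : ℝ) (S : Literature.Probability.LatticeModels.CorrFamily 3), (∀ δ ∈ Set.Ioc (0:ℝ) 1, 0 < ρ δ) ∧ 0 < Δ ∧ Literature.Probability.LatticeModels.HasPointwiseScalingLimit (Literature.Probability.LatticeModels.criticalCorr 3) ρ S ∧ Literature.Probability.LatticeModels.IsNondegenerateTwoPoint S ∧ Literature.Probability.LatticeModels.IsMoebiusCovariant Δ S)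

/-- item stmt-CriticalPhenomena-0636 · crux · rank 6 · open · by planner
why it might fail: No proof that U₄ ≢ 0 in d = 3: via random currents the double-current intersection probability at macroscopic separation must stay > 0 as δ → 0 (open, ICM2022 §8.4); η > 0 does not exclude a generalised free field; RP long-range Ising on ℤ³ (α < 3/2) IS Gaussian (LongRangeTrivialityOnZ3), as d ≥ 4.
sources: AizenmanDuminilCopinAnnals2021, DuminilCopinICM2022, Panis2023Triviality, Literature.Barriers.CriticalPhenomena.IsingTrivialityFromDimensionFour, Literature.Barriers.CriticalPhenomena.LongRangeTrivialityOnZ3, Literature.Probability.LatticeModels.highDim_triviality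
Crux r4 (non-triviality in d=3): every non-degenerate pointwise scaling limit S of the renormalised
critical Ising correlators on Z^3 has connected four-point function U4 ≢ 0 on non-coincident
configurations. Intended tool: the random-current identity U4(x,y,z,t) =
−2⟨σxσy⟩⟨σzσt⟩·P^{xy,zt}[C_{n1+n2}(x) ∩ C_{n1+n2}(z) ≠ ∅] (Aizenman 1982; ADC2021 arXiv:1912.07973
eq. (3.11)): non-Gaussianity ⇔ the intersection probability of the two double-current clusters at
macroscopic separation does not vanish as δ → 0. Contrast: for d ≥ 4 every such limit IS Gaussian
(Literature.Probability.LatticeModels.highDim_triviality). Its negation refutes the conjunct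
Ising3DConformalLimit itself. -/
@[route_item "route-CriticalPhenomena-PrecisionLaplacian", crux]
def IsingEuclidUpgradeR4NonGaussian : Prop :=
  ∀ (ρ : ℝ → ℝ) (S : Literature.Probability.LatticeModels.CorrFamily 3), (∀ δ ∈ Set.Ioc (0:ℝ) 1, 0 < ρ δ) → Literature.Probability.LatticeModels.HasPointwiseScalingLimit (Literature.Probability.LatticeModels.criticalCorr 3) ρ S → Literature.Probability.LatticeModels.IsNondegenerateTwoPoint S → Literature.Probability.LatticeModels.HasNontrivialU4 S

/-- item stmt-CriticalPhenomena-0634 · crux · rank 7 · open · by planner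
why it might fail: A pure isotropic power law can fail three ways: η need not exist (log⟨σ₀σ_x⟩/log|x| may oscillate in Δ ∈ [1/2,1]; η ≤ 1/2 only IF it exists, DCP2025 Thm 1.5), log or log-periodic corrections (RP+GKS+MMS admit them), or cubic anisotropy of the amplitude; proved only by lace expansion (d>4) and in 2D.
sources: DuminilCopinICM2022 §8.1 p.25, DuminilcopinPanis2025 Thm 1.5 (arXiv:2404.05700 p.6), Sakai2007 Thm 1.3, arXiv:2012.11672 Thm 1.2, Literature.Probability.LatticeModels.criticalTwoPoint_bounds, Literature.Barriers.CriticalPhenomena.LaceExpansionIsingAboveFour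
Crux r2 (hardest, most informative): the critical two-point function of the n.n. Ising model on Z^3
is asymptotically a rotation-invariant pure power law: there are Δ and c>0 with ⟨σ_0 σ_x⟩_{β_c(3)} ·
|x|_2^{2Δ} → c as |x| → ∞ (Euclidean norm, cofinite filter on Z^3). Gives existence of η = 2Δ−1,
forces ρ(δ) ≍ δ^{-Δ}, and is rotation invariance at the two-point level (open on Z^3: Duminil-Copin
ICM2022 arXiv:2208.00864 §8; 2-D analogue for FK models: DKKMO arXiv:2012.11672). Known input:
c|x|^{-2} ≤ ⟨σ0σx⟩ ≤ C|x|^{-1} (Literature.Probability.LatticeModels.criticalTwoPoint_bounds), so Δ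
∈ [1/2,1] if it exists. -/
@[route_item "route-CriticalPhenomena-PrecisionLaplacian", crux]
def IsingEuclidUpgradeR2RotInvPowerLaw : Prop :=
  ∃ Δ c : ℝ, 0 < c ∧ Filter.Tendsto (fun x : Literature.Probability.LatticeModels.Site 3 => Literature.Probability.LatticeModels.criticalTwoPoint 3 x * Real.sqrt (∑ i, ((x i : ℝ)) ^ 2) ^ (2 * Δ)) Filter.cofinite (nhds c)

/-- item stmt-CriticalPhenomena-1985 · support · rank 9 · closed · proved by Summit.CriticalPhenomena.Ising3DConformalLimit.HyperoctahedralRPNineMirror.criticalCorrNineMirrorRP_proof (prover) · by planner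
sources: FrohlichEtAl1978, FrohlichIsraelLiebSimon1978, FriedliVelenik2017, stmt-CriticalPhenomena-1985
[support, lattice input, FILS 1978] Nine-mirror reflection positivity of the critical plus-state
correlators on ℤ³: for each site mirror through the origin — coordinate plane x_i = 0 (θ negates
x_i, ℓ = x_i), diagonal plane x_i = x_j (θ swaps, ℓ = x_i − x_j), anti-diagonal x_i = −x_j (θ: x_i ↦
−x_j, x_j ↦ −x_i, ℓ = x_i + x_j) — and finitely many lattice configurations x^a strictly inside {ℓ >
0} with real coefficients c_a: Σ_ab c_a c_b criticalCorr 3 (k_a + k_b) (Fin.append (θ ∘ x^a) x^b) ≥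
0, i.e. ⟨ΘF·F⟩⁺_{β_c} ≥ 0. From the proved tree lemma isingMeasure_univ_free_reflectionPositive (any
involutive graph automorphism with every n.n. edge inside P or θP — true for the swap since a bond
changes x_i − x_j by ±1 and never crosses strictly) on symmetric boxes with + boundary field
(θ-symmetric), hasBoxLimit_isingCorr_plus_holds, and closedness of RP under limits; FrohlichEtAl1978
§3 Thm 3.1 (planes through sites), FriedliVelenik2017 Lemma 10.8. -/
@[route_item "route-CriticalPhenomena-PrecisionLaplacian", crux]
def CriticalCorrNineMirrorRP : Prop :=
  ∀ (θ : Literature.Probability.LatticeModels.Site 3 → Literature.Probability.LatticeModels.Site 3) (ℓ : Literature.Probability.LatticeModels.Site 3 → ℤ), (∃ i j : Fin 3, i ≠ j ∧ ((θ = fun x => Function.update x i (-x i)) ∧ (ℓ = fun x => x i) ∨ (θ = fun x => x ∘ Equiv.swap i j) ∧ (ℓ = fun x => x i - x j) ∨ (θ = fun x => Function.update (Function.update x i (-x j)) j (-x i)) ∧ (ℓ = fun x => x i + x j))) → ∀ (m : ℕ) (k : Fin m → ℕ) (x : (a : Fin m) → Fin (k a) → Literature.Probability.LatticeModels.Site 3)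 (c : Fin m → ℝ), (∀ a i, 0 < ℓ (x a i)) → 0 ≤ ∑ a, ∑ b, c a * c b * Literature.Probability.LatticeModels.criticalCorr 3 (k a + k b) (Fin.append (fun i => θ (x a i)) (x b))

/-- `CriticalCorrNineMirrorRP` holds: proved by `Summit.CriticalPhenomena.Ising3DConformalLimit.HyperoctahedralRPNineMirror.criticalCorrNineMirrorRP_proof`. -/
theorem CriticalCorrNineMirrorRP_holds : CriticalCorrNineMirrorRP := _root_.Summit.CriticalPhenomena.Ising3DConformalLimit.HyperoctahedralRPNineMirror.criticalCorrNineMirrorRP_proof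

/-- item stmt-CriticalPhenomena-4802 · support · rank 9 · closed · proved by Summit.CriticalPhenomena.Ising3DConformalLimit.Theorems.InverseMCriticalKernel_proof (prover) · by planner
sources: DellacherieMartinezSanmartin2014, Georgii2011, FriedliVelenik2017, Literature.Probability.LatticeModels.hasUniqueGibbsMeasure_criticalBeta_holds, Literature.Probability.LatticeModels.twoPointPlus_criticalBeta_eq_twoPointFree
[support] (closure lemma, card M4) InverseMFerromagnet → the critical kernel of ℤ³ is a SYMMETRIC
POTENTIAL on every finite set: for A ⊂ ℤ³ finite, G_A := (criticalTwoPoint 3 (q − p))_{p,q∈A} is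
positive definite, (G_A)⁻¹ has nonpositive off-diagonal entries and nonnegative row sums. Proof
sketch: IM on the n.n. torus (ℤ/Lℤ)³ at β_c (K ≡ β_c, zero field); translation invariance gives
(G_L)⁻¹𝟙 = 𝟙/χ_L ≥ 0, so G_L is a symmetric potential; principal submatrices of symmetric potentials
are symmetric potentials (Schur complement, DMS 2014 ch. 2–3) and entrywise limits with
positive-definite limit stay in the class; torus (or ghost-site plus-box) two-point functions
converge to criticalTwoPoint (hasUniqueGibbsMeasure_criticalBeta_holds,
hasBoxLimit_isingCorr_plus_holds, twoPointPlus_criticalBeta_eq_twoPointFree); positive definiteness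
of the limit by finite energy (conditional variance of σ₀ given the rest is bounded below).
[difficulty: M] -/
@[route_item "route-CriticalPhenomena-PrecisionLaplacian", crux]
def InverseMCriticalKernel : Prop :=
  InverseMFerromagnet → (∀ A : Finset (Literature.Probability.LatticeModels.Site 3), (Matrix.of fun (p q : ↥A) => Literature.Probability.LatticeModels.criticalTwoPoint 3 (q.1 - p.1)).PosDef ∧ ∀ u v : ↥A, (u ≠ v → (Matrix.of fun (p q : ↥A) => Literature.Probability.LatticeModels.criticalTwoPoint 3 (q.1 - p.1))⁻¹ u v ≤ 0) ∧ 0 ≤ ∑ w, (Matrix.of fun (p q : ↥A) => Literature.Probability.LatticeModels.criticalTwoPoint 3 (q.1 - p.1))⁻¹ u w)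

-- `InverseMCriticalKernel` holds: proved by `Summit.CriticalPhenomena.Ising3DConformalLimit.Theorems.InverseMCriticalKernel_proof` (its module imports this route file, so no `_holds` link can be stated here).

/-- item stmt-CriticalPhenomena-4803 · support · rank 9 · closed · proved by Summit.CriticalPhenomena.Ising3DConformalLimit.Theorems.PrecisionIsLaplacian_proof (prover) · by planner
sources: DellacherieMartinezSanmartin2014, KarlinRinott1983, LawlerLimic2010, CampaninoIoffeVelenik2003, Literature.Probability.LatticeModels.criticalTwoPoint_bounds, Summits/CriticalPhenomena/Ising3DConformalLimit/Ideas/precision-is-a-laplacian.md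
[support] (dictionary lemma, card M4/(1): 'the precision operator is a Laplacian') under the
symmetric-potential hypothesis of InverseMCriticalKernel (written out), the function m(y) := inf_{A
∋ 0,y} −((G_A)⁻¹)(0,y) (= a(y) ≥ 0 for y ≠ 0 and = −A₀ := −sup_A (G_A)⁻¹(0,0) < 0 at y = 0) is
summable, sums to ZERO (conservativity: the killing rate κ = A₀ − Σa = lim 1/χ vanishes because
χ(β_c) = ∞, via Bochner + Fejér and G ≥ 0), and is minus the convolution inverse of G: Σ_y
m(y)·G(z−y) = −δ_{z,0}. Hence G = A₀⁻¹ Σ_{n≥0} q^{*n} with probability step law q = a/A₀ on ℤ³∖0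
(transient positive-rate walk; Ornstein–Zernike h = c + c∗h with c ≥ 0), Ĝ = 1/ψ, ψ(k) = Σ_x a(x)(1
− cos k·x) a Lévy–Khintchine exponent, and the infrared bound ψ(k) ≥ ½kᵀ(Σ_{|x|=1}a(x)xxᵀ)k is free.
Ingredients: −(G_A)⁻¹(0,y) ↓ and (G_A)⁻¹(0,0) ↑ in A (Schur complements of M-matrices); no defect
since G → 0 (criticalTwoPoint_bounds); finite energy bounds A₀. [difficulty: M] -/
@[route_item "route-CriticalPhenomena-PrecisionLaplacian"]
def PrecisionIsLaplacian : Prop :=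
  (∀ A : Finset (Literature.Probability.LatticeModels.Site 3), (Matrix.of fun (p q : ↥A) => Literature.Probability.LatticeModels.criticalTwoPoint 3 (q.1 - p.1)).PosDef ∧ ∀ u v : ↥A, (u ≠ v → (Matrix.of fun (p q : ↥A) => Literature.Probability.LatticeModels.criticalTwoPoint 3 (q.1 - p.1))⁻¹ u v ≤ 0) ∧ 0 ≤ ∑ w, (Matrix.of fun (p q : ↥A) => Literature.Probability.LatticeModels.criticalTwoPoint 3 (q.1 - p.1))⁻¹ u w) → Summable (fun y : Literature.Probability.LatticeModels.Site 3 => (⨅ A : {A : Finset (Literature.Probability.LatticeModels.Site 3) // (0 : Literature.Probability.LatticeModels.Site 3) ∈ A ∧ y ∈ A}, -((Matrix.of fun (p q : ↥A.1) => Literature.Probability.LatticeModels.criticalTwoPoint 3 (q.1 - p.1))⁻¹ ⟨0, A.2.1⟩ ⟨y, A.2.2⟩))) ∧ (∑' y : Literature.Probability.LatticeModels.Site 3, (⨅ A : {A : Finset (Literature.Probability.LatticeModels.Site 3) // (0 : Literature.Probability.LatticeModels.Site 3) ∈ A ∧ y ∈ A}, -((Matrix.of fun (p q : ↥A.1) =>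 Literature.Probability.LatticeModels.criticalTwoPoint 3 (q.1 - p.1))⁻¹ ⟨0, A.2.1⟩ ⟨y, A.2.2⟩))) = 0 ∧ (∀ y : Literature.Probability.LatticeModels.Site 3, y ≠ 0 → 0 ≤ (⨅ A : {A : Finset (Literature.Probability.LatticeModels.Site 3) // (0 : Literature.Probability.LatticeModels.Site 3) ∈ A ∧ y ∈ A}, -((Matrix.of fun (p q : ↥A.1) => Literature.Probability.LatticeModels.criticalTwoPoint 3 (q.1 - p.1))⁻¹ ⟨0, A.2.1⟩ ⟨y, A.2.2⟩))) ∧ (⨅ A : {A : Finset (Literature.Probability.LatticeModels.Site 3) // (0 : Literature.Probability.LatticeModels.Site 3) ∈ A ∧ (0 : Literature.Probability.LatticeModels.Site 3) ∈ A}, -((Matrix.of fun (p q : ↥A.1) => Literature.Probability.LatticeModels.criticalTwoPoint 3 (q.1 - p.1))⁻¹ ⟨0, A.2.1⟩ ⟨(0 : Literature.Probability.LatticeModels.Site 3), A.2.2⟩)) < 0 ∧ ∀ z : Literature.Probability.LatticeModels.Site 3, (∑' y : Literature.Probability.LatticeModels.Site 3, (⨅ A : {A : Finset (Literature.Probability.LatticeModels.Site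 3) // (0 : Literature.Probability.LatticeModels.Site 3) ∈ A ∧ y ∈ A}, -((Matrix.of fun (p q : ↥A.1) => Literature.Probability.LatticeModels.criticalTwoPoint 3 (q.1 - p.1))⁻¹ ⟨0, A.2.1⟩ ⟨y, A.2.2⟩)) * Literature.Probability.LatticeModels.criticalTwoPoint 3 (z - y)) = if z = 0 then -1 else 0

-- `PrecisionIsLaplacian` holds: proved by `Summit.CriticalPhenomena.Ising3DConformalLimit.Theorems.PrecisionIsLaplacian_proof` (its module imports this route file, so no `_holds` link can be stated here).

/-- item stmt-CriticalPhenomena-4804 · support · rank 9 · closed · proved by Summit.CriticalPhenomena.Ising3DConformalLimit.Theorems.etaBoundsTransfer_proof @ 0aa2148c2647 (prover) · by planner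
sources: BassLevin2002, DuminilCopinICM2022, Literature.Probability.LatticeModels.HasIsingExponentEta.of_bounded, stmt-CriticalPhenomena-0635
[support] (two-sided dividend, card M2(i) upward; graceful-degradation path to item 0635) under the
symmetric-potential hypothesis, c|x|^(−(5−η)) ≤ a(x) ≤ C|x|^(−(5−η)) for all x ≠ 0 with 0 < η < 1
implies HasIsingEtaBounds 3 η, hence item 0635 (∃η HasIsingExponentEta 3 η) by
HasIsingExponentEta.of_bounded. Proof: G = A₀⁻¹·(Green function of the discrete-time walk with
conductances C_xy = a(y−x) ≍ |x−y|^(−(3+α)), α = 2−η ∈ (1,2)); BassLevin2002 Thm 1.1: p_n(x,y) ≍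
n^(−3/α) ∧ n|x−y|^(−3−α); sum over n. The converse (G two-sided ⇒ a two-sided) is NOT claimed.
[difficulty: M] -/
@[route_item "route-CriticalPhenomena-PrecisionLaplacian"]
def EtaBoundsTransfer : Prop :=
  (∀ A : Finset (Literature.Probability.LatticeModels.Site 3), (Matrix.of fun (p q : ↥A) => Literature.Probability.LatticeModels.criticalTwoPoint 3 (q.1 - p.1)).PosDef ∧ ∀ u v : ↥A, (u ≠ v → (Matrix.of fun (p q : ↥A) => Literature.Probability.LatticeModels.criticalTwoPoint 3 (q.1 - p.1))⁻¹ u v ≤ 0) ∧ 0 ≤ ∑ w, (Matrix.of fun (p q : ↥A) => Literature.Probability.LatticeModels.criticalTwoPoint 3 (q.1 - p.1))⁻¹ u w) → ∀ η : ℝ, 0 < η → η < 1 → (∃ c C : ℝ, 0 < c ∧ ∀ x : Literature.Probability.LatticeModels.Site 3, x ≠ 0 → c * ‖x‖ ^ (-(5 - η)) ≤ (⨅ A : {A : Finset (Literature.Probability.LatticeModels.Site 3) // (0 : Literature.Probability.LatticeModels.Site 3) ∈ A ∧ x ∈ A}, -((Matrix.of fun (p q : ↥A.1) => Literature.Probability.LatticeModels.criticalTwoPoint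 3 (q.1 - p.1))⁻¹ ⟨0, A.2.1⟩ ⟨x, A.2.2⟩)) ∧ (⨅ A : {A : Finset (Literature.Probability.LatticeModels.Site 3) // (0 : Literature.Probability.LatticeModels.Site 3) ∈ A ∧ x ∈ A}, -((Matrix.of fun (p q : ↥A.1) => Literature.Probability.LatticeModels.criticalTwoPoint 3 (q.1 - p.1))⁻¹ ⟨0, A.2.1⟩ ⟨x, A.2.2⟩)) ≤ C * ‖x‖ ^ (-(5 - η))) → Literature.Probability.LatticeModels.HasIsingEtaBounds 3 η

-- `EtaBoundsTransfer` holds: proved by `Summit.CriticalPhenomena.Ising3DConformalLimit.Theorems.etaBoundsTransfer_proof` @ 0aa2148c2647 (its module imports this route file, so no `_holds` link can be stated here).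

/-- item stmt-CriticalPhenomena-4805 · support · rank 9 · closed · proved by Summit.CriticalPhenomena.Ising3DConformalLimit.Theorems.SpineGlue.twoPointSpineGlue_proof @ e6b6b2251a3d (prover) · by planner
sources: Williamson1968, Berger2019, FrohlichIsraelLiebSimon1978, DellacherieMartinezSanmartin2014, stmt-CriticalPhenomena-0634, stmt-CriticalPhenomena-1983
[support] (glue of the foreseen split, kind glue; conclusion = item 0634 verbatim)
symmetric-potential hypothesis → TAIL (conclusion of DirectCorrelationStableTail, written out) →
StableConeRPRigidity → CriticalCorrNineMirrorRP (written out) → ∃ Δ c > 0, ⟨σ₀σ_x⟩_{β_c}·|x|₂^(2Δ) →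
c cofinitely (with 2Δ = 1 + η). Chain: PrecisionIsLaplacian gives G = A₀⁻¹Σ q^{*n}; TAIL puts q in
the domain of normal attraction of a genuinely 3-dimensional symmetric (2−η)-stable law with Lévy
density ∝ |z|^(−5+η)Φ(ẑ) (aperiodic: a > 0 on far sites of an open cone); Williamson1968 (Thm p. 393
for 3/2 < α < 2; Cor. 3-B for d ≥ 2 under the pointwise tail regularity TAIL provides; modern form
Berger2019) gives G(x)·|x|₂^(1+η) − U(x̂) → 0 with U > 0 the continuous degree-(−1−η) potential
kernel of that law; nine-mirror RP and mirror invariance pass from the lattice correlators to K =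
|x|^(−1−η)U(x̂) (finite sums, pointwise limits), which satisfies the potential equation of
StableConeRPRigidity with α = 2 − η; L_iso makes K radial, U ≡ c > 0: item 0634. To be split
(Two-layer plan) once r3 or r4 closes. [difficulty: L] -/
@[route_item "route-CriticalPhenomena-PrecisionLaplacian", crux]
def TwoPointSpineGlue : Prop :=
  (∀ A : Finset (Literature.Probability.LatticeModels.Site 3), (Matrix.of fun (p q : ↥A) => Literature.Probability.LatticeModels.criticalTwoPoint 3 (q.1 - p.1)).PosDef ∧ ∀ u v : ↥A, (u ≠ v → (Matrix.of fun (p q : ↥A) => Literature.Probability.LatticeModels.criticalTwoPoint 3 (q.1 - p.1))⁻¹ u v ≤ 0) ∧ 0 ≤ ∑ w, (Matrix.of fun (p q : ↥A) => Literature.Probability.LatticeModels.criticalTwoPoint 3 (q.1 - p.1))⁻¹ u w) → (∃ (η : ℝ) (Φ : (Fin 3 → ℝ) → ℝ), 0 < η ∧ η < 1 ∧ ContinuousOn Φ {u | ∑ i, u i ^ 2 = 1} ∧ (∀ u : Fin 3 → ℝ, ∑ i, u i ^ 2 = 1 → 0 ≤ Φ u) ∧ (∃ u : Fin 3 → ℝ,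 ∑ i, u i ^ 2 = 1 ∧ 0 < Φ u) ∧ Filter.Tendsto (fun x : Literature.Probability.LatticeModels.Site 3 => (⨅ A : {A : Finset (Literature.Probability.LatticeModels.Site 3) // (0 : Literature.Probability.LatticeModels.Site 3) ∈ A ∧ x ∈ A}, -((Matrix.of fun (p q : ↥A.1) => Literature.Probability.LatticeModels.criticalTwoPoint 3 (q.1 - p.1))⁻¹ ⟨0, A.2.1⟩ ⟨x, A.2.2⟩)) * Real.sqrt (∑ j, ((x j : ℝ)) ^ 2) ^ (5 - η) - Φ (fun i => (x i : ℝ) / Real.sqrt (∑ j, ((x j : ℝ)) ^ 2))) Filter.cofinite (nhds 0)) → StableConeRPRigidity → (∀ (θ : Literature.Probability.LatticeModels.Site 3 → Literature.Probability.LatticeModels.Site 3) (ℓ : Literature.Probability.LatticeModels.Site 3 → ℤ), (∃ i j : Fin 3, i ≠ j ∧ ((θ = fun x => Function.update x i (-x i)) ∧ (ℓ = fun x => x i) ∨ (θ = fun x => x ∘ Equiv.swap i j) ∧ (ℓ = fun x => x i - x j) ∨ (θ = fun x => Function.update (Function.update x i (-x j)) j (-x i)) ∧ (ℓ = fun x =>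 x i + x j))) → ∀ (m : ℕ) (k : Fin m → ℕ) (x : (a : Fin m) → Fin (k a) → Literature.Probability.LatticeModels.Site 3) (c : Fin m → ℝ), (∀ a i, 0 < ℓ (x a i)) → 0 ≤ ∑ a, ∑ b, c a * c b * Literature.Probability.LatticeModels.criticalCorr 3 (k a + k b) (Fin.append (fun i => θ (x a i)) (x b))) → (∃ Δ c : ℝ, 0 < c ∧ Filter.Tendsto (fun x : Literature.Probability.LatticeModels.Site 3 => Literature.Probability.LatticeModels.criticalTwoPoint 3 x * Real.sqrt (∑ i, ((x i : ℝ)) ^ 2) ^ (2 * Δ)) Filter.cofinite (nhds c))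

-- `TwoPointSpineGlue` holds: proved by `Summit.CriticalPhenomena.Ising3DConformalLimit.Theorems.SpineGlue.twoPointSpineGlue_proof` @ e6b6b2251a3d (its module imports this route file, so no `_holds` link can be stated here).

/-- item stmt-CriticalPhenomena-4806 · assembly · rank 1 · closed · proved by Summit.CriticalPhenomena.Ising3DConformalLimit.Theorems.PrecisionLaplacianAssembly_proof @ 20a055b94c44 (prover) · by planner
sources: DuminilCopinICM2022, LauritzenUhlerZwiernik2021, Williamson1968
[assembly] InverseMFerromagnet → DirectCorrelationStableTail → StableConeRPRigidity →
InverseMCriticalKernel → CriticalCorrNineMirrorRP → TwoPointSpineGlue → MoebiusLimitOfTwoPointLaw →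
IsingEuclidUpgradeR4NonGaussian → Ising3DConformalLimit. -/
@[route_item "route-CriticalPhenomena-PrecisionLaplacian"]
def Assembly : Prop :=
  InverseMFerromagnet → DirectCorrelationStableTail → StableConeRPRigidity → InverseMCriticalKernel → CriticalCorrNineMirrorRP → TwoPointSpineGlue → MoebiusLimitOfTwoPointLaw → IsingEuclidUpgradeR4NonGaussian → Ising3DConformalLimit

-- `Assembly` holds: proved by `Summit.CriticalPhenomena.Ising3DConformalLimit.Theorems.PrecisionLaplacianAssembly_proof` @ 20a055b94c44 (its module imports this route file, so no `_holds` link can be stated here).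

/-! D-0027 §2.1 — DECIDING THEOREM (planner-authored via `route open/edit --closes-file`; by planner-rbadge-CriticalPhenomena-PrecisionLapl-76b09c76-g4-0 2026-08-15T16:09:57Z):
its hypotheses are this route's items and its conclusion the sub-problem Statement (glue_lint), and it elaborates with this file. -/

@[closes "route-CriticalPhenomena-PrecisionLaplacian"] theorem closes
    (h_InverseMFerromagnet : InverseMFerromagnet)
    (h_DirectCorrelationStableTail : DirectCorrelationStableTail)
    (h_StableConeRPRigidity : StableConeRPRigidity)
    (h_InverseMCriticalKernel : InverseMCriticalKernel)
    (h_CriticalCorrNineMirrorRP : CriticalCorrNineMirrorRP)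
    (h_TwoPointSpineGlue : TwoPointSpineGlue)
    (h_MoebiusLimitOfTwoPointLaw : MoebiusLimitOfTwoPointLaw)
    (h_IsingEuclidUpgradeR4NonGaussian : IsingEuclidUpgradeR4NonGaussian) :
    _root_.Ising3DConformalLimit := by
  -- symmetric-potential property of the critical kernel (IM ⇒ InverseMCriticalKernel)
  have hPot := h_InverseMCriticalKernel h_InverseMFerromagnet
  -- TAIL: asymptotic homogeneity of the direct correlation function
  have hTail := h_DirectCorrelationStableTail hPot
  -- two-point spine: isotropic pure power law of ⟨σ₀σ_x⟩ at β_c(3) (item 0634)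
  have hLaw := h_TwoPointSpineGlue hPot hTail h_StableConeRPRigidity h_CriticalCorrNineMirrorRP
  -- Möbius-covariant non-degenerate pointwise scaling limit (item 1344)
  obtain ⟨ρ, Δ, S, hρ, hΔ, hlim, hnd, hmoeb⟩ := h_MoebiusLimitOfTwoPointLaw hLaw
  -- clause (iii): non-Gaussianity of that limit (item 0636)
  exact ⟨ρ, Δ, S, hρ, hΔ, hlim, hnd, hmoeb, h_IsingEuclidUpgradeR4NonGaussian ρ S hρ hlim hnd⟩

end Summit.CriticalPhenomena.Ising3DConformalLimit.Theses.PrecisionLaplacian
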